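import Summits.KontsevichZagierPeriods.KontsevichZagierPeriods.Theorems.KzOnePeriodsE1DerivRealLogs
import Literature.NumberTheory.EllipticCurves.RealLatticeRealLocusProofs

/-!
# KontsevichZagierPeriods — kz1p class E1 derivations, part 4: logarithms on the egg component

Cell pub-kz1p (KZ 1-periods), seat b2b-kz1p-2 (IMPLEMENTER), gen 13; helper of the rung-1 item
`stmt-KontsevichZagierPeriods-4990`, companion of `KzOnePeriodsE1DerivRealLogs.lean` (part 2).  Pure
mathematics over the tree's real-lattice theory (`PeriodPair.IsReal`, Lawden §§6.7, 6.10–6.11, 6.15) and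
its uniformisation `φ = (℘, ℘′/2)`; no named facts, no `sorry`, no new definitions.

Part 2 covers rational points on the IDENTITY component `E⁰(ℝ)` of a real curve (`x ≥ e₁`): their
principal logarithms are real.  When `4x³ − g₂x − g₃` has three real roots `e₃ < e₂ < e₁` the real locus
has a second ("egg") component `e₃ ≤ x ≤ e₂`, uniformised by the horizontal half-period line `w_I + ℝ`
with `w_I = iΩ₁'/2`, `Ω₁'` the least positive real period of the real lattice `iΛ` (`2w_I ∈ Λ`,
`w_I ∉ Λ`, `conj w_I = −w_I`: `PeriodPair.IsReal.two_mul_halfPeriodI_mem`; the real locus is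
`(ℝ + Λ) ∪ (w_I + ℝ + Λ)`, `PeriodPair.IsReal.sub_mem_realLocus_iff`).  This file proves what kz1p's
connected E1 derivations need for such points (all three roots rational):

* `phi_halfPeriodI_of_roots`: `φ(w_I) = (e₃, 0)` — the egg component's rational 2-torsion point with the
  SMALLEST abscissa (`℘(w_I) = −℘_{iΛ}(Ω₁'/2) = −e₁(iΛ)` is a real root of `f`, and `f < 0` on `(−∞, ℘(w_I))`
  by `IsReal.cubic_neg_of_lt`, which excludes `e₂` and `e₁`);
* `phi_add_of_ne`, `add_notMem_of_phi_ne`: the chord law AS VALUES, `φ(u + v) = φ(u) ⊕ φ(v)` and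
  `u + v ∉ Λ` for `x(φ(u)) ≠ x(φ(v))` — so that an egg point `P` gets the logarithm `w_I + s` with `s` the
  principal REAL logarithm (part 2) of the identity-component point `P ⊕ (e₃, 0)`; this is kz1p's
  convention `u(P) = ω₂/2 + u(P + T)` (`ellnum.egg_log`), `ω₂ = 2w_I`;
* `halfPeriodI_add_notMem` (`w_I + s ∉ Λ` for `|s| < Ω₁/2`), `phi_halfPeriodI_add_half_of_roots`
  (`φ(w_I + Ω₁/2) = (e₂, 0)`, the egg component's other rational 2-torsion point), `halfPeriodI_add_half_notMem`;
* small glue: `phi_neg_of_phi`, `neg_notMem`, `mem_of_add_int_mul_mem` (strip the `ω₂`-multiples of a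
  lattice relation before pinning its real part in `Λ ∩ ℝ = ℤΩ₁`, `eq_int_mul_of_mem` of part 2).

References: [HuberWustholz2022] §13.1 (pp. 119–121), §18.1 (pp. 160–161); [Lawden1989] D. F. Lawden,
*Elliptic Functions and Applications* (1989), (6.10.11)–(6.10.14), §§6.11, 6.15; [SilvermanAEC2009]
III.2.3 (group law); [CremonaAlgorithms1997] §2.10, §3.4 (real components, `ω₂/2`-shift of egg points).
-/

noncomputable section

open Set Complex
open Literature.NumberTheory.Transcendental Literature.NumberTheory.Transcendental.CurvePeriods
open Literature.NumberTheory.Transcendental.CurvePeriods.Ell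
open scoped PeriodPair ComplexConjugate

namespace Summit.KontsevichZagierPeriods.KzOnePeriods.E1RealLogs

variable {L : PeriodPair}

/-- `w_I = iΩ₁'/2`, `Ω₁'` the least positive real period of the real lattice `iΛ` (local notation). -/
local notation3 (prettyPrint := false) "wI" =>
  (I * ((((PeriodPair.mulLeft I I_ne_zero L).minRealPeriod / 2 : ℝ)) : ℂ))

/-! ### The 2-torsion point `φ(w_I) = (e₃, 0)` -/

/-- **The rational 2-torsion point of the egg component with the smallest abscissa**: if
`4x³ − g₂x − g₃ = 4(x − r₁)(x − r₂)(x − r₃)` with `r₃ < r₂ < r₁` then `φ(w_I) = (r₃, 0)`, `w_I = iΩ₁'/2`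
(`℘′(w_I) = 0` as `2w_I ∈ Λ`; `℘(w_I) = −e₁(iΛ)` is real, a root of `f`, and `f < 0` on `(−∞, ℘(w_I))`,
whereas `f((r₂ + r₃)/2) > 0`). [cite: Lawden1989, (6.10.14) and §6.11] -/
theorem phi_halfPeriodI_of_roots (h : L.IsReal) {r₁ r₂ r₃ : ℝ} (h12 : r₂ < r₁) (h23 : r₃ < r₂)
    (hf : ∀ x, 4 * x ^ 3 - L.g₂.re * x - L.g₃.re = 4 * (x - r₁) * (x - r₂) * (x - r₃)) :
    phi L wI = ![(r₃ : ℂ), 0] := by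
  obtain ⟨h2w, -, hcw⟩ := h.two_mul_halfPeriodI_mem
  have hd : ℘'[L] wI = 0 := PeriodPair.derivWeierstrassP_eq_zero_of_two_mul_mem h2w
  have him : (℘[L] wI).im = 0 := by simpa using h.weierstrassP_line_im h2w hcw 0
  set e := (℘[L] wI).re with he_def
  have hre : e = -(L.mulLeft I I_ne_zero).weierstrassPRe ((L.mulLeft I I_ne_zero).minRealPeriod / 2) := by
    rw [he_def, PeriodPair.weierstrassP_I_mul, Complex.neg_re]; rfl
  have hroot : 4 * e ^ 3 - L.g₂.re * e - L.g₃.re = 0 := by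
    have h0 := h.mulLeft_I.cubic_weierstrassPRe_half
    rw [PeriodPair.g₂_mulLeft_I, PeriodPair.g₃_mulLeft_I, Complex.neg_re] at h0
    rw [hre]; linear_combination (-1 : ℝ) * h0
  have hleft : ∀ x : ℝ, x < e → 4 * x ^ 3 - L.g₂.re * x - L.g₃.re < 0 := fun x hx =>
    h.cubic_neg_of_lt (by rw [← hre]; exact hx)
  have hmid : 0 < 4 * ((r₂ + r₃) / 2) ^ 3 - L.g₂.re * ((r₂ + r₃) / 2) - L.g₃.re := by
    rw [hf]
    have ha : (r₂ + r₃) / 2 - r₁ < 0 := by linarith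
    have hb : (r₂ + r₃) / 2 - r₂ < 0 := by linarith
    have hc : 0 < (r₂ + r₃) / 2 - r₃ := by linarith
    have h4 : 4 * ((r₂ + r₃) / 2 - r₁) * ((r₂ + r₃) / 2 - r₂) * ((r₂ + r₃) / 2 - r₃) =
        4 * (((r₂ + r₃) / 2 - r₁) * ((r₂ + r₃) / 2 - r₂) * ((r₂ + r₃) / 2 - r₃)) := by ring
    rw [h4]
    exact mul_pos (by norm_num) (mul_pos (mul_pos_of_neg_of_neg ha hb) hc)
  have he3 : e = r₃ := by
    have hprod : 4 * (e - r₁) * (e - r₂) * (e - r₃) = 0 := by rw [← hf]; exact hroot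
    rcases mul_eq_zero.1 hprod with h1 | h1
    · exfalso
      have hgt : (r₂ + r₃) / 2 < e := by
        rcases mul_eq_zero.1 h1 with h2 | h2
        · rcases mul_eq_zero.1 h2 with h3 | h3
          · norm_num at h3
          · have : e = r₁ := sub_eq_zero.1 h3
            linarith
        · have : e = r₂ := sub_eq_zero.1 h2
          linarith
      linarith [hleft _ hgt]
    · exact sub_eq_zero.1 h1
  have hP : ℘[L] wI = (r₃ : ℂ) := Complex.ext (by rw [ofReal_re, ← he3]) (by rw [him, ofReal_im])
  funext k; fin_cases k
  · exact hP
  · show ℘'[L] wI / 2 = 0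
    rw [hd, zero_div]

/-! ### The group law as values of `φ` -/

/-- **Chord law (values)**: if `φ(u) = (x₁, y₁)`, `φ(v) = (x₂, y₂)` with `x₁ ≠ x₂` then
`φ(u + v) = (λ² − x₁ − x₂, λ(x₁ − x₃) − y₁)`, `λ = (y₁ − y₂)/(x₁ − x₂)` (addition theorems for `℘`, `℘′`).
[cite: SilvermanAEC2009, III.2.3] -/
theorem phi_add_of_ne {u v : ℂ} (hu : u ∉ L.lattice) (hv : v ∉ L.lattice) {x₁ y₁ x₂ y₂ x₃ y₃ : ℂ}
    (h1 : phi L u = ![x₁, y₁]) (h2 : phi L v = ![x₂, y₂]) (hne : x₁ ≠ x₂)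
    (hx : x₃ = ((y₁ - y₂) / (x₁ - x₂)) ^ 2 - x₁ - x₂)
    (hy : y₃ = (y₁ - y₂) / (x₁ - x₂) * (x₁ - x₃) - y₁) : phi L (u + v) = ![x₃, y₃] := by
  obtain ⟨eu, eu'⟩ := wp_eq_of_phi h1
  obtain ⟨ev, ev'⟩ := wp_eq_of_phi h2
  have hne' : ℘[L] u ≠ ℘[L] v := by rwa [eu, ev]
  have hd : x₁ - x₂ ≠ 0 := sub_ne_zero.2 hne
  have hX : ℘[L] (u + v) = x₃ := by
    rw [L.weierstrassP_add_holds u v hu hv hne', eu, ev, eu', ev', hx]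
    field_simp
    ring
  have hY : ℘'[L] (u + v) = 2 * y₃ := by
    rw [PeriodPair.derivWeierstrassP_add_of_ne hu hv hne', hX, eu, ev, eu', ev', hy]
    field_simp
    ring
  funext k; fin_cases k
  · exact hX
  · show ℘'[L] (u + v) / 2 = y₃
    rw [hY]; ring

/-- Two points with different abscissae do not add up to `O`: `x(φ(u)) ≠ x(φ(v)) ⇒ u + v ∉ Λ`.
[cite: SilvermanAEC2009, III.2.3] -/
theorem add_notMem_of_phi_ne {u v : ℂ} {x₁ y₁ x₂ y₂ : ℂ} (h1 : phi L u = ![x₁, y₁])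
    (h2 : phi L v = ![x₂, y₂]) (hne : x₁ ≠ x₂) : u + v ∉ L.lattice :=
  PeriodPair.add_notMem_lattice_of_weierstrassP_ne (by rwa [(wp_eq_of_phi h1).1, (wp_eq_of_phi h2).1])

/-! ### Logarithms on the line `w_I + ℝ` -/

/-- **Off the lattice**: `w_I + s ∉ Λ` for real `|s| < Ω₁/2` (else `conj`: `2s ∈ Λ ∩ ℝ = ℤΩ₁`, so `s = 0` and
`w_I ∈ Λ`). [cite: Lawden1989, §6.15] -/
theorem halfPeriodI_add_notMem (h : L.IsReal) {s : ℝ} (hlo : -(L.minRealPeriod / 2) < s)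
    (hhi : s < L.minRealPeriod / 2) : wI + (s : ℂ) ∉ L.lattice := by
  obtain ⟨-, hwn, hcw⟩ := h.two_mul_halfPeriodI_mem
  intro hmem
  have hct : -wI + (s : ℂ) ∈ L.lattice := by
    have := h _ hmem
    rwa [map_add, hcw, Complex.conj_ofReal] at this
  have h2s : (((2 * s : ℝ)) : ℂ) ∈ L.lattice := by
    convert add_mem hmem hct using 1
    push_cast; ring
  have hs : 2 * s = ((0 : ℤ) : ℝ) * L.minRealPeriod :=
    eq_int_mul_of_mem h h2s 0 (by push_cast; linarith) (by push_cast; linarith)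
  have hs0 : s = 0 := by push_cast at hs; linarith
  exact hwn (by simpa [hs0] using hmem)

/-- **The other rational 2-torsion point of the egg component**: `φ(w_I + Ω₁/2) = (r₂, 0)` — the chord sum of
`φ(w_I) = (r₃, 0)` and `φ(Ω₁/2) = (e₁, 0) = (r₁, 0)` (`r₁ + r₂ + r₃ = 0`). [cite: Lawden1989, §6.11]
[cite: SilvermanAEC2009, III.2.3] -/
theorem phi_halfPeriodI_add_half_of_roots (h : L.IsReal) {r₁ r₂ r₃ : ℝ} (h12 : r₂ < r₁) (h23 : r₃ < r₂)
    (hf : ∀ x, 4 * x ^ 3 - L.g₂.re * x - L.g₃.re = 4 * (x - r₁) * (x - r₂) * (x - r₃)) :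
    phi L (wI + ((L.minRealPeriod / 2 : ℝ) : ℂ)) = ![(r₂ : ℂ), 0] := by
  have hΩ := h.minRealPeriod_pos
  have hsum : r₁ + r₂ + r₃ = 0 := by linear_combination (hf 1 + hf (-1) - 2 * hf 0) / 8
  have hsumC : (r₁ : ℂ) + r₂ + r₃ = 0 := by exact_mod_cast hsum
  have h1 : phi L ((L.minRealPeriod / 2 : ℝ) : ℂ) = ![(r₁ : ℂ), 0] := by
    rw [phi_half_period h, weierstrassPRe_half_eq_of_roots h h12 h23 hf]
  have hne : (r₃ : ℂ) ≠ (r₁ : ℂ) := by exact_mod_cast (h23.trans h12).ne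
  exact phi_add_of_ne h.two_mul_halfPeriodI_mem.2.1 (notMem_of_pos h (by positivity) le_rfl)
    (phi_halfPeriodI_of_roots h h12 h23 hf) h1 hne (by rw [sub_self, zero_div]; linear_combination hsumC)
    (by rw [sub_self, zero_div]; ring)

/-- `w_I + Ω₁/2 ∉ Λ` (`φ(w_I) = (r₃, 0) ≠ (r₁, 0) = φ(−Ω₁/2)`). [cite: Lawden1989, §6.11] -/
theorem halfPeriodI_add_half_notMem (h : L.IsReal) {r₁ r₂ r₃ : ℝ} (h12 : r₂ < r₁) (h23 : r₃ < r₂)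
    (hf : ∀ x, 4 * x ^ 3 - L.g₂.re * x - L.g₃.re = 4 * (x - r₁) * (x - r₂) * (x - r₃)) :
    wI + ((L.minRealPeriod / 2 : ℝ) : ℂ) ∉ L.lattice := by
  have h1 : phi L ((L.minRealPeriod / 2 : ℝ) : ℂ) = ![(r₁ : ℂ), 0] := by
    rw [phi_half_period h, weierstrassPRe_half_eq_of_roots h h12 h23 hf]
  have hne : (r₃ : ℂ) ≠ (r₁ : ℂ) := by exact_mod_cast (h23.trans h12).ne
  exact add_notMem_of_phi_ne (phi_halfPeriodI_of_roots h h12 h23 hf) h1 hne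

/-- The negative of a point: `φ(−u) = (x, −y)`. [cite: SilvermanAEC2009, III.2.3] -/
theorem phi_neg_of_phi {u : ℂ} {x y y' : ℂ} (h : phi L u = ![x, y]) (hy : y' = -y) :
    phi L (-u) = ![x, y'] := by
  have e1 : ℘[L] u = x := by simpa using congrFun h 0
  have e2 : ℘'[L] u / 2 = y := by simpa using congrFun h 1
  rw [phi_neg, e1, e2, hy]

/-- `u ∉ Λ ⇒ −u ∉ Λ`. -/
theorem neg_notMem {u : ℂ} (hu : u ∉ L.lattice) : -u ∉ L.lattice :=
  fun h => hu (by simpa using neg_mem h)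

/-- Strip an integer multiple of a period from a lattice relation: `z + k·p ∈ Λ`, `p ∈ Λ ⇒ z ∈ Λ` (used with
`p = ω₂ = 2w_I` before pinning the real part of a relation in `Λ ∩ ℝ = ℤΩ₁`). -/
theorem mem_of_add_int_mul_mem {z p : ℂ} (k : ℤ) (hp : p ∈ L.lattice) (hz : z + (k : ℂ) * p ∈ L.lattice) :
    z ∈ L.lattice := by
  have hk : (k : ℂ) * p ∈ L.lattice := by simpa [zsmul_eq_mul] using zsmul_mem hp k
  simpa using sub_mem hz hk

end Summit.KontsevichZagierPeriods.KzOnePeriods.E1RealLogs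

end
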